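import Mathlib
import Literature.Analysis.FluidPDE.SereginSverakPressureProofs
import Literature.Analysis.FluidPDE.SuitableWeakRescaling
import Literature.Analysis.FluidPDE.LocalTypeI
import HarnessLib

/-!
# PressureFreeEpsilonRegularity

Topic `Literature/Analysis/FluidPDE`. Named literature fact(s) relocated by the gate from `Summits/NavierStokesRegularity/NavierStokesRegularity/Theorems/SelfMixingDichotomySequentialTypeIExclusionSmallReynoldsCorner.lean`
(accept-time relocation of `[cite]`d propositions written inline in a Summits proposal; human ruling 2026-08-15).
Sources: Kwon2023RolePressure.

* `Literature.Analysis.FluidPDE.kwon2023_velocity_epsilon_regularity`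
-/

namespace Literature.Analysis.FluidPDE

open scoped ENNReal NNReal Topology
open Literature.Analysis.FluidPDE Set Filter MeasureTheory Function Metric

/-- **Kwon 2023, Theorem 1.4 (ε-regularity WITHOUT smallness of the pressure), cubic case, for
suitable weak solutions.** Printed (H. Kwon, *The role of the pressure in the regularity theory for
the Navier–Stokes equations*, J. Differential Equations (2023) = arXiv:2104.03160, Thm. 1.4): "For
any `r, m ∈ (2, ∞]` with `2/r + 3/m < 2`, we can find `ε = ε(r, m) > 0` and a universal constant
`C > 0` such that for any dissipative solution to (NS) on `Q₂` satisfying `‖u‖_{L^r_t L^m_x(Q₂)} ≤ ε`,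
we have a decomposition `u = v + h` on `Q₁` such that `h` is a harmonic function on `Q₁` with
`‖∇ᵏh‖_{L^∞((−t₀,0)×B₁)} ≲_k ‖u‖_{L^∞(−t₀,0;L¹(B₂))}` for any integer `k ≥ 0` and `t₀ ∈ (0, 1]`, and
`‖v‖_{C^α_par(Q_{1/2})} ≤ C` for some `α ∈ (0, 1/2 − 1/r)`. In particular,
`‖u‖_{L^∞_t C^α_x(Q_{1/2})} ≤ C + ‖u‖_{L^∞(−1/4,0;L¹(B₂))}`." Here (NS) is the unforced system with
viscosity `1`, `Q_ρ = (t₀ − ρ², t₀) × B_ρ(x₀)` are BACKWARD cylinders at an arbitrary point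
`z₀ = (t₀, x₀)` (the paper's *Notations*), and a *dissipative weak solution* on `Q₂` (Def. 1.1,
after Duchon–Robert / Chamorro–Lemarié-Rieusset–Mayoufi) is a pair with
`u ∈ L^∞_t L²_x(Q₂) ∩ L²_t Ḣ¹_x(Q₂)`, `p ∈ 𝒟'(Q₂)`, solving (NS) in the sense of distributions and
the local energy inequality in the sense of distributions; "any suitable weak solution is a
dissipative solution" (§1, p. 3; suitable = Scheffer / Caffarelli–Kohn–Nirenberg / Lin:
additionally `p ∈ L^{3/2}(Q₂)`, for which the distributional pressure term is `∬ p u·∇ξ`).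
**Recorded special case** (`r = m = 3`, so `2/3 + 3/3 < 2`; qualitative conclusion), in the tree's
vocabulary and at an arbitrary scale `ρ > 0` by the scaling `u_λ(t,x) = λu(λ²t, λx)`,
`p_λ = λ²p(λ²t, λx)` and translation ("Due to the translation and scale invariance of the
Navier–Stokes equations, one can work on `Q₁` without loss of generality", §1 p. 1; the smallness is
recorded scale-invariantly as `ρ⁻² ∬_{Q_ρ} |u|³ ≤ ε`, i.e. `cknC ρ z₀ u ≤ ε`, the printed `Q₂ → Q_{1/2}`
becoming `Q_ρ → Q_{ρ/4}`): there is `ε > 0` such that for every `z₀`, every `ρ > 0` and every suitable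
weak solution `(u, p)` of Navier–Stokes (`ν = 1`, `f = 0`) on the open cylinder `Q_ρ(z₀)`
(`IsSuitableWeakSolutionOn`, CKN (2.1)–(2.5) locally) which lies in the classes of Def. 1.1 /
Scheffer on the WHOLE cylinder — `esssup_t ρ⁻¹∫_{B_ρ}|u(t)|² < ∞` (`cknAEss`), `ρ⁻¹∬_{Q_ρ}|∇u|² < ∞`
for a weak spatial gradient (`cknE`), `ρ⁻²∬_{Q_ρ}|p|^{3/2} < ∞` (`cknD`) — the smallness
`cknC ρ z₀ u ≤ ε` implies that `u` is essentially bounded on `Q_{ρ/4}(z₀)` (the printed bound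
`C + ‖u‖_{L^∞_t L¹_x}` is finite by `u ∈ L^∞_t L²_x`; the `C^α_x`-norm dominates the sup norm).
-- TODO(general form): the mixed-norm range `2/r + 3/m < 2`, `r, m ∈ (2, ∞]`, the harmonic/Hölder
decomposition `u = v + h`, and the distributional-pressure (dissipative / Wolf local suitable) class.
Locators: Thm. 1.4 (arXiv:2104.03160, p. 4); Def. 1.1; §1 p. 3 (suitable weak solutions are
dissipative solutions); §1 p. 1 (scaling and translation).
[cite: Kwon2023RolePressure, Thm. 1.4] [file Analysis/FluidPDE/PressureFreeEpsilonRegularity] -/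
def kwon2023_velocity_epsilon_regularity : Prop :=
  ∃ ε : ℝ, 0 < ε ∧
    ∀ (u : ℝ → EuclideanSpace ℝ (Fin 3) → EuclideanSpace ℝ (Fin 3))
      (p : ℝ → EuclideanSpace ℝ (Fin 3) → ℝ) (z₀ : ℝ × EuclideanSpace ℝ (Fin 3)) (ρ : ℝ), 0 < ρ →
      Literature.Analysis.FluidPDE.IsSuitableWeakSolutionOn
          (Literature.Analysis.FluidPDE.parabolicCylinderOpens ρ z₀) 1 0 u p →
      Literature.Analysis.FluidPDE.cknAEss ρ z₀ u < ⊤ →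
      (∃ G : ℝ → EuclideanSpace ℝ (Fin 3) → EuclideanSpace ℝ (Fin 3) →L[ℝ] EuclideanSpace ℝ (Fin 3),
          Literature.Analysis.FluidPDE.HasWeakSpatialGradientOn
              (Literature.Analysis.FluidPDE.parabolicCylinderOpens ρ z₀) u G ∧
            Literature.Analysis.FluidPDE.cknE ρ z₀ G < ⊤) →
      Literature.Analysis.FluidPDE.cknD ρ z₀ p < ⊤ →
      Literature.Analysis.FluidPDE.cknC ρ z₀ u ≤ ENNReal.ofReal ε →
      MeasureTheory.eLpNorm (Function.uncurry u) ⊤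
          (MeasureTheory.volume.restrict
            (Literature.Analysis.FluidPDE.parabolicCylinder (ρ / 4) z₀)) < ⊤

end Literature.Analysis.FluidPDE
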